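import Summits.AnomalousDissipation.AnomalousDissipation.Theses.BaireTransfer
import Summits.AnomalousDissipation.AnomalousDissipation.Theorems.WindLineWindyGalerkinSteadyZerothLawRobustBirth
import Summits.AnomalousDissipation.AnomalousDissipation.Theorems.WindLineWindyGalerkinSteadyZerothLawForceDictionary
import Literature.Analysis.FunctionSpaces.TorusSpaceTimeFields
import Literature.Analysis.FunctionSpaces.TorusFourierCalculus
import Literature.Analysis.FluidPDE.SteadyNSLatticePersistence
import Literature.Analysis.FluidPDE.SteadyGalerkinApprox
import Literature.Analysis.FluidPDE.LongTimeAveragePeriodic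

/-!
# The WindLine physics stub implies BaireTransfer's TARGET: P ≡ R₀ ⇒ `BaireTransfer.BaireTarget` (stmt-AnomalousDissipation-1145)

Support file for crux `WindLine.WindyGalerkinSteadyZerothLaw` (stmt-AnomalousDissipation-11414; pure proof file).  The robust form R₀
of the line's registered stub P (`robustLoud_of_nonMeagreLoud`, landed): a non-empty OPEN set `U` of the parameter space `𝒜 ⊆ SymL2`
of entire forces, every one of which carries at every level `j` a loud bounded classical steady state of `NS_{ν_j}(F⟦c⟧)`.  Route
BaireTransfer asks (its target `BaireTarget`, rank 0) for a finite frequency stock `S`, budgets and a non-empty open `U_S ⊆ P_S = (↥S → ℂ³)`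
such that at every level the ROBUSTLY loud coefficient vectors — those `c` whose steady trig-poly force
`f_c = realTrigPoly S (k ↦ Π_k (coeffExt S c k))` drives, at SOME `ν < 1/(j+1)`, a periodic classical NS solution with `meanEnergy ≤ E`,
`meanDissipation ≥ ε` — have dense interior in `U_S`.

`baireTarget_of_robustLoud` / `baireTarget_of_nonMeagreLoud` prove R₀ ⇒ BaireTarget ⇐ P: truncate a point `c₀ ∈ U` to the punctured
ball `S = freqBall N ∖ {0}` (`SymL2.trunc N c₀ → c₀`), read coefficient vectors `c ∈ P_S` as parameters `param c ∈ 𝒜` through the Fourier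
coefficients of `f_c` (real part of a trig poly: `𝓕(f_c)(k) = ½(d_k + conj d_{−k})`, `d = Π ∘ coeffExt S c`, supported in `S`,
transversal, conjugation symmetric; `F⟦param c⟧ = f_c`), note that `c ↦ param c` is Lipschitz (`norm_param_sub_param_le`), so a small
ball `U_S` around the coefficient vector of `F⟦c₀⟧|_S` is mapped into `U`; there every force is loud at every level with STEADY witnesses,
which are `τ`-periodic classical solutions of momentum `m_j` whose period means are `∫|u|²` and `ν‖∇u‖²`; `ν_j → 0` supplies a level
below `1/(j+1)`, and an open subset of `LOUD_j` lies in its interior.  So the WindLine line's physics debt sits ABOVE BaireTransfer's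
target; 1143 (`DenseLoudDesignerForces`, all stocks `S₀`, possibly `0 ∈ S₀`) is not
claimed.

References: route files `Theses/BaireTransfer.lean`, `Theses/WindLine.lean`; Foias–Temam 1976 (generic force families); Grafakos 2014
§3.1–3.2 (Fourier coefficients of real parts and trigonometric polynomials).
-/

noncomputable section

-- D-0017: single-problem summit ⇒ the duplicated namespace segment is by design.
set_option linter.dupNamespace false

open scoped InnerProductSpace Topology ComplexConjugate
open MeasureTheory Filter UnitAddTorus Set
open Literature.Analysis.FunctionSpaces Literature.Analysis.FunctionSpaces.Torus
open Literature.Analysis.FunctionSpaces.EuclideanSpace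
open Literature.Analysis.FluidPDE Literature.Analysis.FluidPDE.Torus
open Literature.Analysis.FluidPDE.SteadyLattice

namespace Summit.AnomalousDissipation.AnomalousDissipation.Theorems.WindLineWindyGalerkinSteadyZerothLaw

/-! ## §1 Fourier coefficients of the BaireTransfer trig-poly forces on a punctured ball -/

/-- The punctured frequency balls are symmetric. -/
theorem bt_negMem (N : ℕ) : ∀ k ∈ (freqBall (d := Fin 3) N).erase 0, -k ∈ (freqBall (d := Fin 3) N).erase 0 :=
  neg_mem_freqBall_erase_zero

/-- **Fourier coefficients of the BaireTransfer force** `f_c = realTrigPoly S (k ↦ Π_k (coeffExt S c k))` (any complex coefficient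
vector `c`): `𝓕(f_c)(k) = ½ (d̃ k + conj (d̃ (−k)))`, `d̃ k = [k ∈ S] Π_k (coeffExt S c k)`. [Grafakos 2014 §3.1.1] -/
theorem bt_mFourierCoeff_force (S : Finset (Fin 3 → ℤ)) (c : ↥S → EuclideanSpace ℂ (Fin 3)) (k : Fin 3 → ℤ) :
    mFourierCoeff (complexify ∘ realTrigPoly S (fun l => lerayCoeff l (coeffExt S c l))) k =
      (2 : ℂ)⁻¹ • ((if k ∈ S then lerayCoeff k (coeffExt S c k) else 0) +
        conjVec (if -k ∈ S then lerayCoeff (-k) (coeffExt S c (-k)) else 0)) := by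
  have hint : Integrable (trigPoly S fun l => lerayCoeff l (coeffExt S c l)) volume :=
    (continuous_trigPoly S _).integrable_unitAddTorus
  rw [realTrigPoly_eq_comp, show (complexify ∘ (realPart ∘ trigPoly S fun l => lerayCoeff l (coeffExt S c l))) =
      (complexify ∘ fun x => realPart (trigPoly S (fun l => lerayCoeff l (coeffExt S c l)) x)) from rfl,
    mFourierCoeff_complexify_realPart_comp hint, mFourierCoeff_trigPoly, mFourierCoeff_trigPoly]

/-- Off the (symmetric) stock the Fourier coefficients of the force vanish. -/
theorem bt_mFourierCoeff_force_eq_zero (N : ℕ) (c : ↥((freqBall (d := Fin 3) N).erase 0) → EuclideanSpace ℂ (Fin 3))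
    {k : Fin 3 → ℤ} (hk : k ∉ (freqBall (d := Fin 3) N).erase 0) :
    mFourierCoeff (complexify ∘ realTrigPoly ((freqBall (d := Fin 3) N).erase 0)
      (fun l => lerayCoeff l (coeffExt ((freqBall (d := Fin 3) N).erase 0) c l))) k = 0 := by
  have hk' : -k ∉ (freqBall (d := Fin 3) N).erase 0 := fun h => hk (by simpa using bt_negMem N (-k) h)
  rw [bt_mFourierCoeff_force, if_neg hk, if_neg hk', conjVec_zero, add_zero, smul_zero]

/-- The coefficient difference of two forces at one frequency is controlled by the sup distance of the coefficient vectors. -/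
theorem bt_norm_mFourierCoeff_force_sub_le (S : Finset (Fin 3 → ℤ)) (c c' : ↥S → EuclideanSpace ℂ (Fin 3)) (k : Fin 3 → ℤ) :
    ‖mFourierCoeff (complexify ∘ realTrigPoly S (fun l => lerayCoeff l (coeffExt S c l))) k -
      mFourierCoeff (complexify ∘ realTrigPoly S (fun l => lerayCoeff l (coeffExt S c' l))) k‖ ≤ ‖c - c'‖ := by
  have hd : ∀ l, ‖(if l ∈ S then lerayCoeff l (coeffExt S c l) else 0) - (if l ∈ S then lerayCoeff l (coeffExt S c' l) else 0)‖
      ≤ ‖c - c'‖ := by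
    intro l
    by_cases hl : l ∈ S
    · rw [if_pos hl, if_pos hl, ← lerayCoeff_sub', ← Pi.sub_apply, ← coeffExt_sub]
      exact (norm_lerayCoeff_le l _).trans (norm_coeffExt_le _ l)
    · rw [if_neg hl, if_neg hl, sub_zero, norm_zero]
      exact norm_nonneg _
  rw [bt_mFourierCoeff_force, bt_mFourierCoeff_force, ← smul_sub, norm_smul, norm_inv, Complex.norm_two]
  have h1 := hd k
  have h2 : ‖conjVec (if -k ∈ S then lerayCoeff (-k) (coeffExt S c (-k)) else 0) -
      conjVec (if -k ∈ S then lerayCoeff (-k) (coeffExt S c' (-k)) else 0)‖ ≤ ‖c - c'‖ := by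
    rw [← conjVec_sub, norm_conjVec]
    exact hd (-k)
  calc 2⁻¹ * ‖(if k ∈ S then lerayCoeff k (coeffExt S c k) else 0) +
          conjVec (if -k ∈ S then lerayCoeff (-k) (coeffExt S c (-k)) else 0) -
        ((if k ∈ S then lerayCoeff k (coeffExt S c' k) else 0) +
          conjVec (if -k ∈ S then lerayCoeff (-k) (coeffExt S c' (-k)) else 0))‖
      ≤ 2⁻¹ * (‖c - c'‖ + ‖c - c'‖) := by
        rw [add_sub_add_comm]
        gcongr
        exact (norm_add_le _ _).trans (add_le_add h1 h2)
    _ = ‖c - c'‖ := by ring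


/-! ## §2 Coefficient vectors of `P_S` as parameters of `𝒜` -/

set_option quotPrecheck false in
/-- **The admissible parameter set** `𝒜 ⊆ SymL2 (Fin 3)` (local notation, as in the sibling files). -/
local notation "𝒜" => ({c : SymL2 (Fin 3) | c 0 = 0 ∧
  ∀ k : Fin 3 → ℤ, ∑ j : Fin 3, ((k j : ℤ) : ℂ) * c k j = 0} : Set (SymL2 (Fin 3)))
/-- **The force of a parameter** (local notation, as in the sibling files). -/
local notation "F⟦" c "⟧" => SymL2.field (fun k : Fin 3 → ℤ => Real.exp (freqNormSq k)) (c : SymL2 (Fin 3))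

/-- **The parameter map of a punctured ball `S = freqBall N ∖ {0}`.**  There is `Φ : P_S → 𝒜` with (i) `F⟦Φ c⟧ = f_c`, the
BaireTransfer force of `c`; (ii) `Φ` Lipschitz from the sup norm of `P_S` to `SymL2` with constant `|S|·e^{N²}`; (iii) `Φ` of the
coefficient vector `k ↦ e^{−|k|²} c₀ k` of `F⟦c₀⟧|_S` is the truncation `SymL2.trunc N c₀`, for every `c₀ ∈ 𝒜`.  Construction:
`(Φ c) k = e^{|k|²} 𝓕(f_c)(k)` (finitely supported, conjugation symmetric, transversal, no zero mode). -/
theorem bt_exists_param (N : ℕ) :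
    ∃ Φ : (↥((freqBall (d := Fin 3) N).erase 0) → EuclideanSpace ℂ (Fin 3)) → 𝒜,
      (∀ c, F⟦Φ c⟧ = realTrigPoly ((freqBall (d := Fin 3) N).erase 0)
        (fun l => lerayCoeff l (coeffExt ((freqBall (d := Fin 3) N).erase 0) c l))) ∧
      (∀ c c', ‖((Φ c : 𝒜) : SymL2 (Fin 3)) - ((Φ c' : 𝒜) : SymL2 (Fin 3))‖ ≤
        ((((freqBall (d := Fin 3) N).erase 0).card : ℝ) * Real.exp ((N : ℝ) ^ 2)) * ‖c - c'‖) ∧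
      (∀ c₀ : 𝒜, ((Φ (fun k => ((Real.exp (freqNormSq (k : Fin 3 → ℤ)) : ℂ))⁻¹ • (c₀ : SymL2 (Fin 3)) k) : 𝒜) :
        SymL2 (Fin 3)) = SymL2.trunc N (c₀ : SymL2 (Fin 3))) := by
  set S : Finset (Fin 3 → ℤ) := (freqBall (d := Fin 3) N).erase 0 with hSdef
  have hS : ∀ k ∈ S, -k ∈ S := bt_negMem N
  have hS0 : (0 : Fin 3 → ℤ) ∉ S := by simp [hSdef]
  have hSN : ∀ k ∈ S, freqNormSq k ≤ (N : ℝ) ^ 2 := fun k hk => mem_freqBall.1 (Finset.mem_of_mem_erase hk)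
  -- the Fourier family of the force of a coefficient vector
  set a : (↥S → EuclideanSpace ℂ (Fin 3)) → (Fin 3 → ℤ) → EuclideanSpace ℂ (Fin 3) := fun c k =>
    mFourierCoeff (complexify ∘ realTrigPoly S (fun l => lerayCoeff l (coeffExt S c l))) k with ha
  have hfs : ∀ c : ↥S → EuclideanSpace ℂ (Fin 3), IsSmooth (realTrigPoly S (fun l => lerayCoeff l (coeffExt S c l))) :=
    fun c => isSmooth_realTrigPoly _ _
  have hfd : ∀ c : ↥S → EuclideanSpace ℂ (Fin 3), IsDivFree (realTrigPoly S (fun l => lerayCoeff l (coeffExt S c l))) :=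
    fun c => isDivFree_realTrigPoly fun k _ => kdot_lerayCoeff k _
  have ha0 : ∀ c, ∀ k ∉ S, a c k = 0 := fun c k hk => bt_mFourierCoeff_force_eq_zero N c hk
  have hacs : ∀ c, IsConjSymm (a c) := fun c => isConjSymm_mFourierCoeff (hfs c).integrable
  have hat : ∀ c (k : Fin 3 → ℤ), ∑ j : Fin 3, ((k j : ℤ) : ℂ) * a c k j = 0 := fun c k =>
    (hfd c).sum_mul_mFourierCoeff_eq_zero (hfs c) k
  -- the weighted family
  set b : (↥S → EuclideanSpace ℂ (Fin 3)) → (Fin 3 → ℤ) → EuclideanSpace ℂ (Fin 3) := fun c k =>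
    ((Real.exp (freqNormSq k) : ℝ) : ℂ) • a c k with hb
  have hb0 : ∀ c, ∀ k ∉ S, b c k = 0 := fun c k hk => by simp only [hb, ha0 c k hk, smul_zero]
  have hbcs : ∀ c, IsConjSymm (b c) := fun c k => by
    simp only [hb]
    rw [freqNormSq_neg, hacs c k, conjVec_smul, Complex.conj_ofReal]
  have hbt : ∀ c (k : Fin 3 → ℤ), ∑ j : Fin 3, ((k j : ℤ) : ℂ) * b c k j = 0 := fun c k => by
    simp only [hb]
    rw [kdot_smul, hat c k, mul_zero]
  have hmem : ∀ c, SymL2.ofFinSupp (b c) S (hb0 c) (hbcs c) ∈ 𝒜 := fun c => ⟨hb0 c 0 hS0, fun k => hbt c k⟩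
  refine ⟨fun c => ⟨SymL2.ofFinSupp (b c) S (hb0 c) (hbcs c), hmem c⟩, fun c => ?_, fun c c' => ?_, fun c₀ => ?_⟩
  · -- (i) same Fourier coefficients, both continuous
    have hexp : ∀ k : Fin 3 → ℤ, ((Real.exp (freqNormSq k) : ℝ) : ℂ) ≠ 0 := fun k =>
      Complex.ofReal_ne_zero.2 (Real.exp_pos _).ne'
    have hcoef : ∀ k, mFourierCoeff (complexify ∘ F⟦SymL2.ofFinSupp (b c) S (hb0 c) (hbcs c)⟧) k =
        mFourierCoeff (complexify ∘ realTrigPoly S (fun l => lerayCoeff l (coeffExt S c l))) k := by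
      intro k
      rw [forceDict_mFourierCoeff, SymL2.ofFinSupp_apply]
      simp only [hb]
      rw [inv_smul_smul₀ (hexp k)]
    have h1 : Continuous (complexify ∘ F⟦SymL2.ofFinSupp (b c) S (hb0 c) (hbcs c)⟧) :=
      (forceDict_isSmooth _).complexify_comp.continuous
    have h2 : Continuous (complexify ∘ realTrigPoly S (fun l => lerayCoeff l (coeffExt S c l))) :=
      (hfs c).complexify_comp.continuous
    have hae := ae_eq_of_forall_mFourierCoeff_eq h1.integrable_unitAddTorus h2.integrable_unitAddTorus hcoef
    have heq := (Continuous.ae_eq_iff_eq volume h1 h2).1 hae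
    funext x
    exact complexify_injective (congrFun heq x)
  · -- (ii) Lipschitz estimate: finitely many coordinates, each controlled by `bt_norm_mFourierCoeff_force_sub_le`
    set M : ℝ := (S.card : ℝ) * Real.exp ((N : ℝ) ^ 2) with hM
    have hM0 : 0 ≤ M := by positivity
    have hsub : ∀ k, ((⟨SymL2.ofFinSupp (b c) S (hb0 c) (hbcs c), hmem c⟩ : 𝒜) : SymL2 (Fin 3)) k -
        ((⟨SymL2.ofFinSupp (b c') S (hb0 c') (hbcs c'), hmem c'⟩ : 𝒜) : SymL2 (Fin 3)) k = b c k - b c' k := fun k => rfl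
    have hterm : ∀ k, ‖b c k - b c' k‖ ≤ Real.exp ((N : ℝ) ^ 2) * ‖c - c'‖ := by
      intro k
      by_cases hk : k ∈ S
      · simp only [hb]
        rw [← smul_sub, norm_smul, Complex.norm_real, Real.norm_of_nonneg (Real.exp_pos _).le]
        exact mul_le_mul (Real.exp_le_exp.2 (hSN k hk)) (bt_norm_mFourierCoeff_force_sub_le S c c' k) (norm_nonneg _)
          (Real.exp_pos _).le
      · rw [hb0 c k hk, hb0 c' k hk, sub_zero, norm_zero]
        positivity
    have hsum : HasSum (fun k => ‖b c k - b c' k‖ ^ 2) (∑ k ∈ S, ‖b c k - b c' k‖ ^ 2) :=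
      hasSum_sum_of_ne_finset_zero fun k hk => by rw [hb0 c k hk, hb0 c' k hk, sub_zero, norm_zero, zero_pow two_ne_zero]
    have hnorm := SymL2.hasSum_norm_sq (((⟨SymL2.ofFinSupp (b c) S (hb0 c) (hbcs c), hmem c⟩ : 𝒜) : SymL2 (Fin 3)) -
      ((⟨SymL2.ofFinSupp (b c') S (hb0 c') (hbcs c'), hmem c'⟩ : 𝒜) : SymL2 (Fin 3)))
    simp only [SymL2.sub_apply, hsub] at hnorm
    have heq := hnorm.unique hsum
    have hle : ‖((⟨SymL2.ofFinSupp (b c) S (hb0 c) (hbcs c), hmem c⟩ : 𝒜) : SymL2 (Fin 3)) -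
        ((⟨SymL2.ofFinSupp (b c') S (hb0 c') (hbcs c'), hmem c'⟩ : 𝒜) : SymL2 (Fin 3))‖ ^ 2 ≤ (M * ‖c - c'‖) ^ 2 := by
      rw [heq]
      calc ∑ k ∈ S, ‖b c k - b c' k‖ ^ 2 ≤ ∑ k ∈ S, (Real.exp ((N : ℝ) ^ 2) * ‖c - c'‖) ^ 2 :=
            Finset.sum_le_sum fun k _ => pow_le_pow_left₀ (norm_nonneg _) (hterm k) 2
        _ = (S.card : ℝ) * (Real.exp ((N : ℝ) ^ 2) * ‖c - c'‖) ^ 2 := by rw [Finset.sum_const, nsmul_eq_mul]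
        _ ≤ (S.card : ℝ) ^ 2 * (Real.exp ((N : ℝ) ^ 2) * ‖c - c'‖) ^ 2 := by
            refine mul_le_mul_of_nonneg_right ?_ (sq_nonneg _)
            have h : (S.card : ℝ) ≤ (S.card : ℝ) ^ 2 := by
              rcases Nat.eq_zero_or_pos S.card with h0 | hpos
              · simp [h0]
              · have h1 : (1 : ℝ) ≤ S.card := by exact_mod_cast hpos
                nlinarith
            exact h
        _ = (M * ‖c - c'‖) ^ 2 := by rw [hM]; ring
    exact (pow_le_pow_iff_left₀ (norm_nonneg _) (by positivity) two_ne_zero).1 hle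
  · -- (iii) the coefficient vector of `F⟦c₀⟧|_S` is sent to the truncation of `c₀`
    set c₀' : ↥S → EuclideanSpace ℂ (Fin 3) := fun k => ((Real.exp (freqNormSq (k : Fin 3 → ℤ)) : ℂ))⁻¹ • (c₀ : SymL2 (Fin 3)) k
      with hc₀'
    -- the extended family and the projected family agree
    set e : (Fin 3 → ℤ) → EuclideanSpace ℂ (Fin 3) := coeffExt S c₀' with he
    have he_mem : ∀ k ∈ S, e k = ((Real.exp (freqNormSq k) : ℂ))⁻¹ • (c₀ : SymL2 (Fin 3)) k := fun k hk => by
      rw [he, coeffExt_of_mem _ hk]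
    have he_not : ∀ k ∉ S, e k = 0 := fun k hk => by rw [he, coeffExt_of_not_mem _ hk]
    have het : ∀ k : Fin 3 → ℤ, ∑ j : Fin 3, ((k j : ℤ) : ℂ) * e k j = 0 := by
      intro k
      by_cases hk : k ∈ S
      · rw [he_mem k hk, kdot_smul, c₀.2.2 k, mul_zero]
      · rw [he_not k hk]
        simp
    have hd : (fun l => lerayCoeff l (coeffExt S c₀' l)) = e := by
      funext l
      rw [← he]
      by_cases hl : l ∈ S
      · exact lerayCoeff_of_kdot_eq_zero (fun h => hS0 (h ▸ hl)) (het l)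
      · rw [he_not l hl]
        simp [Torus.lerayCoeff]
    have hecs : IsConjSymm e := by
      intro k
      by_cases hk : k ∈ S
      · rw [he_mem (-k) (hS k hk), he_mem k hk, freqNormSq_neg, SymL2.apply_neg, conjVec_smul, map_inv₀, Complex.conj_ofReal]
      · have hk' : -k ∉ S := fun h => hk (by simpa using hS (-k) h)
        rw [he_not _ hk', he_not _ hk, conjVec_zero]
    refine SymL2.ext fun k => ?_
    change b c₀' k = SymL2.trunc N (c₀ : SymL2 (Fin 3)) k
    rw [SymL2.trunc_apply]
    simp only [hb, ha]
    rw [hd, mFourierCoeff_realTrigPoly hS hecs k]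
    by_cases hk : k ∈ S
    · rw [if_pos hk, he_mem k hk, smul_inv_smul₀ (Complex.ofReal_ne_zero.2 (Real.exp_pos _).ne'),
        if_pos (Finset.mem_of_mem_erase hk)]
    · rw [if_neg hk, smul_zero]
      by_cases hk0 : k = 0
      · subst hk0
        rw [if_pos (by simp [mem_freqBall, freqNormSq_zero]), c₀.2.1]
      · rw [if_neg (fun h => hk (Finset.mem_erase.2 ⟨hk0, h⟩))]


/-! ## §3 R₀ ⇒ BaireTarget, hence P ⇒ BaireTarget -/

/-- **R₀ ⇒ `BaireTransfer.BaireTarget` (stmt-AnomalousDissipation-1145) BY NAME.**  Given an open set `U ∋ c₀` of entire forces each of which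
carries at every level a loud bounded classical steady state: pick `ρ` with the `ρ`-ball of `𝒜` around `c₀` inside `U`, `N` with
`‖trunc N c₀ − c₀‖ < ρ/2` (`SymL2.tendsto_trunc`), `S = freqBall N ∖ {0}`, the parameter map `Φ` of `bt_exists_param` and the small sup-ball
`U_S` around the coefficient vector of `F⟦c₀⟧|_S` that `Φ` (Lipschitz) maps into the `ρ`-ball; for `c ∈ U_S` the force `f_c = F⟦Φ c⟧`
carries at every level a steady witness, which is a `1`-periodic classical solution with `meanEnergy = ∫|u|² < E` and
`meanDissipation = ν‖∇u‖² > ε` (`meanEnergy_eq_of_periodic`, `meanDissipation_eq_of_periodic`, smooth slice); `ν_j → 0` supplies a level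
below `1/(j+1)`, and the open `U_S ⊆ LOUD_j` lies in `interior LOUD_j`. -/
theorem baireTarget_of_robustLoud
    (hR : ∃ (ν : ℕ → ℝ) (m : ℕ → EuclideanSpace ℝ (Fin 3)) (E ε : ℝ), (∀ j, 0 < ν j) ∧ Tendsto ν atTop (𝓝 0) ∧ 0 < ε ∧
      ∃ U : Set 𝒜, IsOpen U ∧ U.Nonempty ∧
        ∀ c ∈ U, ∀ j, ∃ (u : UnitAddTorus (Fin 3) → EuclideanSpace ℝ (Fin 3)) (p : UnitAddTorus (Fin 3) → ℝ),
          IsSteadyNSState (ν j) F⟦c⟧ u p ∧ ∫ x, u x = m j ∧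
            ∫ x, ‖u x‖ ^ 2 < E ∧ ε < ν j * gradNormSq u) :
    Summit.AnomalousDissipation.AnomalousDissipation.Theses.BaireTransfer.BaireTarget := by
  obtain ⟨ν, m, E, ε, hν, hν0, hε, U, hUo, ⟨c₀, hc₀⟩, hU⟩ := hR
  -- a metric ball of `𝒜` around `c₀` inside `U`
  obtain ⟨ρ, hρ, hball⟩ := Metric.isOpen_iff.1 hUo c₀ hc₀
  -- truncation level
  have htr := SymL2.tendsto_trunc (c₀ : SymL2 (Fin 3))
  obtain ⟨N, hN⟩ := (Metric.tendsto_atTop.1 htr (ρ / 2) (by positivity))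
  have hN' : ‖SymL2.trunc N (c₀ : SymL2 (Fin 3)) - (c₀ : SymL2 (Fin 3))‖ < ρ / 2 := by
    rw [← dist_eq_norm]
    exact hN N le_rfl
  set S : Finset (Fin 3 → ℤ) := (freqBall (d := Fin 3) N).erase 0 with hSdef
  obtain ⟨Φ, hΦf, hΦlip, hΦtr⟩ := bt_exists_param N
  set L : ℝ := (S.card : ℝ) * Real.exp ((N : ℝ) ^ 2) with hL
  have hL0 : 0 ≤ L := by positivity
  -- the centre of the coefficient ball and its radius
  set c₀' : ↥S → EuclideanSpace ℂ (Fin 3) := fun k => ((Real.exp (freqNormSq (k : Fin 3 → ℤ)) : ℂ))⁻¹ • (c₀ : SymL2 (Fin 3)) k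
    with hc₀'
  have hΦc₀ : ((Φ c₀' : 𝒜) : SymL2 (Fin 3)) = SymL2.trunc N (c₀ : SymL2 (Fin 3)) := hΦtr c₀
  set r : ℝ := ρ / (2 * (L + 1)) with hr
  have hr0 : 0 < r := by positivity
  -- every coefficient vector of the ball is a parameter of `U`
  have hin : ∀ c : ↥S → EuclideanSpace ℂ (Fin 3), c ∈ Metric.ball c₀' r → Φ c ∈ U := by
    intro c hc
    apply hball
    rw [Metric.mem_ball, Subtype.dist_eq, dist_eq_norm]
    have h1 : ‖((Φ c : 𝒜) : SymL2 (Fin 3)) - ((Φ c₀' : 𝒜) : SymL2 (Fin 3))‖ < ρ / 2 := by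
      refine (hΦlip c c₀').trans_lt ?_
      rw [Metric.mem_ball, dist_eq_norm] at hc
      have h2 : L * ‖c - c₀'‖ ≤ L * r := mul_le_mul_of_nonneg_left hc.le hL0
      have h3 : L * r < ρ / 2 := by
        rw [hr]
        have hL1 : 0 < L + 1 := by positivity
        calc L * (ρ / (2 * (L + 1))) = (ρ / 2) * (L / (L + 1)) := by field_simp
          _ < (ρ / 2) * 1 := by
              refine mul_lt_mul_of_pos_left ?_ (by positivity)
              rw [div_lt_one hL1]
              linarith
          _ = ρ / 2 := mul_one _
      exact h2.trans_lt h3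
    calc ‖((Φ c : 𝒜) : SymL2 (Fin 3)) - (c₀ : SymL2 (Fin 3))‖
        = ‖(((Φ c : 𝒜) : SymL2 (Fin 3)) - ((Φ c₀' : 𝒜) : SymL2 (Fin 3))) +
            (SymL2.trunc N (c₀ : SymL2 (Fin 3)) - (c₀ : SymL2 (Fin 3)))‖ := by rw [hΦc₀, sub_add_sub_cancel]
      _ ≤ ‖((Φ c : 𝒜) : SymL2 (Fin 3)) - ((Φ c₀' : 𝒜) : SymL2 (Fin 3))‖ +
            ‖SymL2.trunc N (c₀ : SymL2 (Fin 3)) - (c₀ : SymL2 (Fin 3))‖ := norm_add_le _ _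
      _ < ρ / 2 + ρ / 2 := add_lt_add h1 hN'
      _ = ρ := by ring
  -- the witnesses
  refine ⟨S, E, ε, hε, Metric.ball c₀' r, Metric.isOpen_ball, ⟨c₀', Metric.mem_ball_self hr0⟩, fun j => ?_⟩
  -- a level below `1/(j+1)`
  have hlev : ∃ n : ℕ, ν n < 1 / ((j : ℝ) + 1) :=
    (hν0.eventually (gt_mem_nhds (by positivity : (0 : ℝ) < 1 / ((j : ℝ) + 1)))).exists
  obtain ⟨n, hn⟩ := hlev
  refine (interior_maximal (fun c hc => ?_) Metric.isOpen_ball).trans subset_closure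
  obtain ⟨u, p, hst, -, hE, hεu⟩ := hU (Φ c) (hin c hc) n
  have hsm : IsSmooth u := hst.smooth_velocity.isSmooth_slice (Set.mem_univ (0 : ℝ))
  refine ⟨ν n, hν n, hn, 1, fun _ => u, fun _ => p, one_pos, ?_, fun _ => rfl, ?_, ?_⟩
  · -- the steady state as a classical solution driven by `f_c = F⟦Φ c⟧`
    have h := hst
    unfold IsSteadyNSState at h
    rw [hΦf c] at h
    exact h
  · rw [meanEnergy_eq_of_periodic (τ := 1) (fun _ => rfl) one_pos]
    simpa using hE.le
  · rw [meanDissipation_eq_of_periodic (τ := 1) (fun _ => rfl) one_pos]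
    simpa [← gradNormSq_eq_toReal_eGradNormSq_holds hsm] using hεu.le

/-- **P ⇒ `BaireTransfer.BaireTarget`**: the registered physics stub of line `registered` (category form, `stub_nonMeagreLoudSteadyForces`)
implies route BaireTransfer's TARGET, through the landed `robustLoud_of_nonMeagreLoud` (P ⇒ R₀) and `baireTarget_of_robustLoud`. -/
theorem baireTarget_of_nonMeagreLoud :
    (∃ (ν : ℕ → ℝ) (m : ℕ → EuclideanSpace ℝ (Fin 3)) (E ε : ℝ), (∀ j, 0 < ν j) ∧ Tendsto ν atTop (𝓝 0) ∧ 0 < ε ∧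
      ¬ IsMeagre {c : 𝒜 | ∀ j, ∃ (u : UnitAddTorus (Fin 3) → EuclideanSpace ℝ (Fin 3)) (p : UnitAddTorus (Fin 3) → ℝ),
          IsSteadyNSState (ν j) F⟦c⟧ u p ∧ ∫ x, u x = m j ∧
            ∫ x, ‖u x‖ ^ 2 < E ∧ ε < ν j * gradNormSq u}) →
    Summit.AnomalousDissipation.AnomalousDissipation.Theses.BaireTransfer.BaireTarget :=
  fun hP => baireTarget_of_robustLoud (robustLoud_of_nonMeagreLoud hP)

end Summit.AnomalousDissipation.AnomalousDissipation.Theorems.WindLineWindyGalerkinSteadyZerothLaw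

end
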